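import Mathlib
import HarnessLib
import Literature.MathematicalPhysics.StatisticalMechanics.FluctuationKernelComparisonProperty
import Literature.MathematicalPhysics.StatisticalMechanics.StepMeasureComparisonTraceSegment

/-!
# Lipschitz dependence of the integration map on the step kernel, DIMENSION-FREE form:
# `‖R_{𝒞a}K − R_{𝒞b}K‖_{T, w_{k:k+1}^X} ≤ C · (r₀+1) · 8q · h_T · (A𝒫p^{|X|_k})^{1/p}`
# ([ABKM19] Lemma 8.4, `ℓ = 1`, with the Hilbert–Schmidt pricing of [Buc16] Thm 4.5)

`FluctuationKernelComparison.tayNormLE_fluct_sub_fluct` proves [ABKM19] Lemma 8.4 (`ℓ = 1`) with the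
CRUDE Gaussian comparison, whose constant `gaussCompConst(|Λ|, q) · δ` grows exponentially in the number
`|Λ| = M^d` of Gaussian modes (`δ` = the SUPREMUM over modes of the relative difference of the two
multipliers).  This file reruns the same proof — derivative of the lift of `R_𝒞 K` under the integral,
shift invariance, zero-mode regularisation `N(0, circulant 𝒞 + 𝟙𝟙ᵀ) = N(0, mulMat m)`, Hölder, the
`L^p`-bound of the weights by `StepMeasureScaling` — with the dimension-free comparison of two multiplier
Gaussians in its no-smallness segment form
`StepMeasureComparisonTraceSegment.norm_integral_mulMat_sub_le_of_sum_sq_segment`: the price is the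
HILBERT–SCHMIDT size `h_T`, `h_T² ≥ Σ_κ ρ(κ)²`, of a MODE-WISE two-sided relative bound
`|Re 𝒞̂a(κ) − Re 𝒞̂b(κ)| ≤ ρ(κ) Re 𝒞̂a(κ)`, `≤ ρ(κ) Re 𝒞̂b(κ)`, and the `L^p` weight bound is required
along the segment of kernels `𝒞_t = 𝒞b + t(𝒞a − 𝒞b)`, `t ∈ [0,1]` (in the renormalisation group the
multiplier domination `p · Re 𝒞̂ ≤ (1+ρ'')ĉ_{k+1}` is convex in the kernel, so it holds along the segment
when it holds at the ends):

* **`tayNormLE_fluct_sub_fluct_of_sum_sq`** —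
  `‖fluct 𝒞a K − fluct 𝒞b K‖_{T, w_{k:k+1}^X} ≤ C · ((r₀+1) · (8 q h_T) · (A𝒫p^{|X|_k})^{1/p})`;
* `tayNormLE_fluct_sub_fluct_of_sum_sq_abkm`, `tayNormLE_fluct_sub_fluct_of_sum_sq_pow_abkm` — the same
  for the torus norm parameters `abkmNormParams` (gauge kills constants; weights local and dominated), the
  latter with the constant in the product form `b · ℓ · κ^{|X|_k}`, `ℓ = (r₀+1)·8q·h_T`, `κ = A𝒫p^{1/p}`.

No factor depends on `|Λ|`; the volume enters only through `h_T`, which the small-torus localisation and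
the shell arithmetic of [Buc16] (4.36)–(4.37) bound by `C(d,L)^{1/2}(2L|X|_k)^{d/2}·|q − q'|` (not here).
Everything is proved; no named fact.

## References
* S. Adams, S. Buchholz, R. Kotecký, S. Müller, arXiv:1910.13564, Lemma 8.4, Theorem 6.2, Remark 7.4
  [AdamsBuchholzKoteckyMuller2019].
* S. Buchholz, J. Funct. Anal. 275 (2018), Thm 4.5, (4.36)–(4.37) [Buchholz2016].
-/

noncomputable section

namespace Literature.MathematicalPhysics.StatisticalMechanics.GradientRG

open scoped BigOperators Matrix ENNReal
open MeasureTheory ProbabilityTheory Finset WithLp Matrix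
open Literature.MathematicalPhysics.StatisticalMechanics.GradientFRD (mulMat fourierCoeff
  re_fourierCoeff_zero_of_sum_eq_zero circulant_eq_mulMat posSemidef_mulMat)
open Literature.MathematicalPhysics.StatisticalMechanics.TorusPolymer (IsPolymer numBlocks)
open Literature.MathematicalPhysics.QuantumFieldTheory

variable {d M : ℕ} [NeZero M]

/-! ## The multipliers of the kernel segment -/

/-- The Fourier coefficients are affine along the kernel segment `𝒞b + t(𝒞a − 𝒞b)`.
[cite: Buchholz2016, §2 (2.14)] -/
theorem fourierCoeff_kernelSeg (𝒞a 𝒞b : (Fin d → ZMod M) → ℝ) (t : ℝ) (κ : Fin d → ZMod M) :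
    fourierCoeff (fun x => 𝒞b x + t * (𝒞a x - 𝒞b x)) κ =
      fourierCoeff 𝒞b κ + (t : ℂ) * (fourierCoeff 𝒞a κ - fourierCoeff 𝒞b κ) := by
  unfold GradientFRD.fourierCoeff
  rw [← Finset.sum_sub_distrib, Finset.mul_sum, ← Finset.sum_add_distrib]
  refine Finset.sum_congr rfl fun x _ => ?_
  push_cast
  ring

/-- Real parts of the multipliers along the kernel segment: `Re 𝒞̂_t = Re 𝒞̂b + t (Re 𝒞̂a − Re 𝒞̂b)`.
[cite: Buchholz2016, §2 (2.14)] -/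
theorem re_fourierCoeff_kernelSeg (𝒞a 𝒞b : (Fin d → ZMod M) → ℝ) (t : ℝ) (κ : Fin d → ZMod M) :
    (fourierCoeff (fun x => 𝒞b x + t * (𝒞a x - 𝒞b x)) κ).re =
      (fourierCoeff 𝒞b κ).re + t * ((fourierCoeff 𝒞a κ).re - (fourierCoeff 𝒞b κ).re) := by
  rw [fourierCoeff_kernelSeg, Complex.add_re, Complex.re_ofReal_mul, Complex.sub_re]

omit [NeZero M] in
/-- The kernel segment of two even kernels is even. [cite: Buchholz2016, §1 (1.5)] -/
theorem kernelSeg_even {𝒞a 𝒞b : (Fin d → ZMod M) → ℝ} (hea : ∀ x, 𝒞a (-x) = 𝒞a x)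
    (heb : ∀ x, 𝒞b (-x) = 𝒞b x) (t : ℝ) (x : Fin d → ZMod M) :
    𝒞b (-x) + t * (𝒞a (-x) - 𝒞b (-x)) = 𝒞b x + t * (𝒞a x - 𝒞b x) := by
  rw [hea, heb]

/-- The kernel segment of two zero-sum kernels has zero sum. [cite: Buchholz2016, §1 (1.5)] -/
theorem kernelSeg_sum_eq_zero {𝒞a 𝒞b : (Fin d → ZMod M) → ℝ} (h0a : ∑ x, 𝒞a x = 0)
    (h0b : ∑ x, 𝒞b x = 0) (t : ℝ) : ∑ x, (𝒞b x + t * (𝒞a x - 𝒞b x)) = 0 := by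
  rw [Finset.sum_add_distrib, ← Finset.mul_sum, Finset.sum_sub_distrib, h0a, h0b]
  ring

/-- The regularised multiplier segment is the regularised multiplier of the kernel segment:
`mulMat (m_b + t (m_a − m_b)) = circulant 𝒞_t + 𝟙𝟙ᵀ` with `m = Re 𝒞̂ + M^d 1_{κ=0}`.
[cite: AdamsBuchholzKoteckyMuller2019, Remark 7.4] -/
theorem mulMat_mulSeg_eq_circulant_kernelSeg_add_constMat {𝒞a 𝒞b : (Fin d → ZMod M) → ℝ}
    (hea : ∀ x, 𝒞a (-x) = 𝒞a x) (heb : ∀ x, 𝒞b (-x) = 𝒞b x) (c t : ℝ) :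
    mulMat (fun κ => ((fourierCoeff 𝒞b κ).re + if κ = 0 then c * (M : ℝ) ^ d else 0) +
        t * (((fourierCoeff 𝒞a κ).re + if κ = 0 then c * (M : ℝ) ^ d else 0) -
          ((fourierCoeff 𝒞b κ).re + if κ = 0 then c * (M : ℝ) ^ d else 0))) =
      Matrix.circulant (fun x => 𝒞b x + t * (𝒞a x - 𝒞b x)) + constMat c := by
  rw [circulant_add_constMat_eq_mulMat (kernelSeg_even hea heb t) c]
  congr 1
  funext κ
  rw [re_fourierCoeff_kernelSeg]
  split_ifs <;> ring

/-- Along the segment of two kernels with nonnegative multipliers the circulant matrix is positive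
semi-definite (`t ∈ [0,1]`). [cite: AdamsBuchholzKoteckyMuller2019, Lemma 7.7 (7.75)] -/
theorem posSemidef_circulant_kernelSeg {𝒞a 𝒞b : (Fin d → ZMod M) → ℝ}
    (hea : ∀ x, 𝒞a (-x) = 𝒞a x) (heb : ∀ x, 𝒞b (-x) = 𝒞b x)
    (ha : ∀ κ, 0 ≤ (fourierCoeff 𝒞a κ).re) (hb : ∀ κ, 0 ≤ (fourierCoeff 𝒞b κ).re)
    {t : ℝ} (ht0 : 0 ≤ t) (ht1 : t ≤ 1) :
    (Matrix.circulant (fun x => 𝒞b x + t * (𝒞a x - 𝒞b x))).PosSemidef := by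
  rw [circulant_eq_mulMat (kernelSeg_even hea heb t)]
  refine posSemidef_mulMat fun κ => ?_
  rw [re_fourierCoeff_kernelSeg]
  have : (fourierCoeff 𝒞b κ).re + t * ((fourierCoeff 𝒞a κ).re - (fourierCoeff 𝒞b κ).re) =
      (1 - t) * (fourierCoeff 𝒞b κ).re + t * (fourierCoeff 𝒞a κ).re := by ring
  rw [this]
  exact add_nonneg (mul_nonneg (by linarith) (hb κ)) (mul_nonneg ht0 (ha κ))

/-! ## Lemma 8.4 with `ℓ = 1`, dimension-free -/

set_option maxHeartbeats 1600000 in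
/-- **[ABKM19] Lemma 8.4, `ℓ = 1`, DIMENSION-FREE form: the integration map is Lipschitz in the step
kernel, priced by the Hilbert–Schmidt size of the relative change of the multipliers.**  Let `W` be
local dominated weight data, `𝒞a, 𝒞b` even zero-sum step kernels with `StepKernelBounds` at scale
`k` and positive multipliers off the zero mode; let `ρ ≥ 0` be a MODE-WISE two-sided relative bound,
`|Re 𝒞̂a(κ) − Re 𝒞̂b(κ)| ≤ ρ(κ) Re 𝒞̂a(κ)` and `≤ ρ(κ) Re 𝒞̂b(κ)`, with `Σ_κ ρ(κ)² ≤ h_T²`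
(`h_T ≥ 0`); let `p, q` be Hölder conjugate and let the dilated kernels `p·𝒞_t` of the segment
`𝒞_t = 𝒞b + t(𝒞a − 𝒞b)`, `t ∈ [0,1]`, satisfy `StepKernelBounds` with constant `A𝒫p`.  Then for a
`k`-polymer `X`, a gauge `T` killing the constants and a `T`-local `C^{r₀}` functional `K` with
`‖K‖_{T, w_k^X} ≤ C`:
`‖fluct 𝒞a K − fluct 𝒞b K‖_{T, w_{k:k+1}^X} ≤ C · ((r₀+1) · (8 q h_T) · (A𝒫p^{|X|_k})^{1/p})` — no
dependence on the number of modes. [cite: AdamsBuchholzKoteckyMuller2019, Lemma 8.4] -/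
theorem tayNormLE_fluct_sub_fluct_of_sum_sq (W : WeightData (Fin d → ZMod M))
    {nb : ℕ → Finset (Fin d → ZMod M) → Finset (Fin d → ZMod M)} (hWl : W.Local nb)
    {Dm : ℕ → Matrix (Fin d → ZMod M) (Fin d → ZMod M) ℝ} (hD : W.Dominated Dm)
    {L k : ℕ} {A𝒫a A𝒫b A𝒫p C₂a C₂b C₂p : ℝ} {𝒞a 𝒞b : (Fin d → ZMod M) → ℝ}
    (hSa : StepKernelBounds W L k A𝒫a C₂a 𝒞a) (hSb : StepKernelBounds W L k A𝒫b C₂b 𝒞b)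
    {p q : ℝ} (hpq : p.HolderConjugate q)
    (hSp : ∀ t ∈ Set.Icc (0 : ℝ) 1,
      StepKernelBounds W L k A𝒫p C₂p (fun x => p * (𝒞b x + t * (𝒞a x - 𝒞b x))))
    (hea : ∀ x, 𝒞a (-x) = 𝒞a x) (heb : ∀ x, 𝒞b (-x) = 𝒞b x)
    (h0a : ∑ x, 𝒞a x = 0) (h0b : ∑ x, 𝒞b x = 0)
    (hposa : ∀ κ, κ ≠ 0 → 0 < (fourierCoeff 𝒞a κ).re)
    (hposb : ∀ κ, κ ≠ 0 → 0 < (fourierCoeff 𝒞b κ).re)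
    {ρ : (Fin d → ZMod M) → ℝ} (hρ : ∀ κ, 0 ≤ ρ κ)
    (hcmpa : ∀ κ, |(fourierCoeff 𝒞a κ).re - (fourierCoeff 𝒞b κ).re| ≤ ρ κ * (fourierCoeff 𝒞a κ).re)
    (hcmpb : ∀ κ, |(fourierCoeff 𝒞a κ).re - (fourierCoeff 𝒞b κ).re| ≤ ρ κ * (fourierCoeff 𝒞b κ).re)
    {hS : ℝ} (hhS : 0 ≤ hS) (hsum : ∑ κ, ρ κ ^ 2 ≤ hS ^ 2)
    {X : Finset (Fin d → ZMod M)} (hX : IsPolymer (L ^ k) X)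
    {V : Type*} [NormedAddCommGroup V] [NormedSpace ℝ V]
    (T : ((Fin d → ZMod M) → ℝ) →ₗ[ℝ] V) (hT : ∀ a : ℝ, T (fun _ => a) = 0)
    {r₀ : ℕ} {K : ((Fin d → ZMod M) → ℝ) → ℂ} {C : ℝ}
    (hC : 0 ≤ C) (hKd : ContDiff ℝ r₀ K) (hKloc : IsGaugeLocal T K)
    (hK : TayNormLE T r₀ (W.weight k X) K C) :
    TayNormLE T r₀ (W.midWeight k X) (fluct 𝒞a K - fluct 𝒞b K)
      (C * ((r₀ + 1) * (8 * q * hS) * (A𝒫p ^ numBlocks (L ^ k) X) ^ (1 / p))) := by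
  intro φ
  have hp1 : 1 < p := hpq.lt
  have hp0 : 0 < p := by linarith
  have hq0 : 0 < q := by linarith [hpq.symm.lt]
  have hpE : ENNReal.ofReal p ≠ 0 := by simp [hp0]
  set Kbar := gaugeLift T K with hKbar
  have hKbar_d : ContDiff ℝ r₀ Kbar := contDiff_gaugeLift T hKd
  set Ap := A𝒫p ^ numBlocks (L ^ k) X with hAp
  have hwm := W.midWeight_pos k X φ
  have hAp0 : 0 ≤ Ap := by
    by_contra hneg
    push Not at hneg
    have h1 := (hSp 0 ⟨le_rfl, zero_le_one⟩).pow_mul_midWeight_nonneg hX φ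
    exact absurd h1 (not_le.2 (mul_neg_of_neg_of_pos hneg hwm))
  -- the regularised multipliers
  set ma : (Fin d → ZMod M) → ℝ :=
    fun κ => (fourierCoeff 𝒞a κ).re + if κ = 0 then (1 : ℝ) * (M : ℝ) ^ d else 0 with hma
  set mb : (Fin d → ZMod M) → ℝ :=
    fun κ => (fourierCoeff 𝒞b κ).re + if κ = 0 then (1 : ℝ) * (M : ℝ) ^ d else 0 with hmb
  have hSa_eq : Matrix.circulant 𝒞a + constMat 1 = mulMat ma := circulant_add_constMat_eq_mulMat hea 1
  have hSb_eq : Matrix.circulant 𝒞b + constMat 1 = mulMat mb := circulant_add_constMat_eq_mulMat heb 1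
  have h0a' : 0 ≤ (fourierCoeff 𝒞a 0).re := re_fourierCoeff_zero_nonneg_of_sum_eq_zero h0a
  have h0b' : 0 ≤ (fourierCoeff 𝒞b 0).re := re_fourierCoeff_zero_nonneg_of_sum_eq_zero h0b
  have hma_pos : ∀ κ, 0 < ma κ := re_fourierCoeff_add_zeroModeMul_pos hposa h0a' one_pos
  have hmb_pos : ∀ κ, 0 < mb κ := re_fourierCoeff_add_zeroModeMul_pos hposb h0b' one_pos
  have hma_ev : ∀ κ, ma (-κ) = ma κ := re_fourierCoeff_add_zeroModeMul_neg hea 1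
  have hmb_ev : ∀ κ, mb (-κ) = mb κ := re_fourierCoeff_add_zeroModeMul_neg heb 1
  have hdiff : ∀ κ, ma κ - mb κ = (fourierCoeff 𝒞a κ).re - (fourierCoeff 𝒞b κ).re := by
    intro κ; simp only [hma, hmb]; ring
  have hρb : ∀ κ, |ma κ - mb κ| ≤ ρ κ * mb κ := by
    intro κ
    rw [hdiff]
    refine (hcmpb κ).trans (mul_le_mul_of_nonneg_left ?_ (hρ κ))
    simp only [hmb]
    split_ifs <;> [exact le_add_of_nonneg_right (by positivity); exact (add_zero _).symm.le]
  have hρa : ∀ κ, |ma κ - mb κ| ≤ ρ κ * ma κ := by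
    intro κ
    rw [hdiff]
    refine (hcmpa κ).trans (mul_le_mul_of_nonneg_left ?_ (hρ κ))
    simp only [hma]
    split_ifs <;> [exact le_add_of_nonneg_right (by positivity); exact (add_zero _).symm.le]
  -- nonnegative multipliers (for the segment)
  have hnna : ∀ κ, 0 ≤ (fourierCoeff 𝒞a κ).re := fun κ => by
    by_cases hκ : κ = 0
    · rw [hκ]; exact h0a'
    · exact (hposa κ hκ).le
  have hnnb : ∀ κ, 0 ≤ (fourierCoeff 𝒞b κ).re := fun κ => by
    by_cases hκ : κ = 0
    · rw [hκ]; exact h0b'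
    · exact (hposb κ hκ).le
  -- the segment of regularised multipliers is the regularisation of the kernel segment
  have hmt_eq : ∀ t : ℝ, mulMat (fun κ => mb κ + t * (ma κ - mb κ)) =
      Matrix.circulant (fun x => 𝒞b x + t * (𝒞a x - 𝒞b x)) + constMat 1 := fun t =>
    mulMat_mulSeg_eq_circulant_kernelSeg_add_constMat hea heb 1 t
  have hpsd_t : ∀ t ∈ Set.Icc (0 : ℝ) 1,
      (Matrix.circulant (fun x => 𝒞b x + t * (𝒞a x - 𝒞b x))).PosSemidef := fun t ht =>
    posSemidef_circulant_kernelSeg hea heb hnna hnnb ht.1 ht.2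
  -- `T.rangeRestrict` kills the constants
  have hTr : ∀ a : ℝ, T.rangeRestrict (fun _ : Fin d → ZMod M => a) = 0 := fun a =>
    Subtype.ext (hT a)
  -- per-order estimate
  have hterm : ∀ s, s ≤ r₀ →
      ‖iteratedFDeriv ℝ s (gaugeLift T (fluct 𝒞a K - fluct 𝒞b K)) (T.rangeRestrict φ)‖ ≤
        (s.factorial : ℝ) * C * (8 * q * hS * Ap ^ (1 / p)) * W.midWeight k X φ := by
    intro s hs
    have hs' : (s : WithTop ℕ∞) ≤ r₀ := by exact_mod_cast hs
    set G : ((Fin d → ZMod M) → ℝ) → _ :=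
      fun ζ => iteratedFDeriv ℝ s Kbar (T.rangeRestrict φ + T.rangeRestrict ζ) with hG
    -- (1) the derivative of the lift of the difference
    have hDa := hK.derivDominated_section hC hKd (hSa.weightSectionDominated hD X T)
    have hDb := hK.derivDominated_section hC hKd (hSb.weightSectionDominated hD X T)
    have hlift_a : gaugeLift T (fluct 𝒞a K) =
        fun w => ∫ ζ, Kbar (w + T.rangeRestrict ζ) ∂(stepMeasure 𝒞a) := by
      funext w; exact gaugeLift_integral_comp_add hKloc _ w
    have hlift_b : gaugeLift T (fluct 𝒞b K) =
        fun w => ∫ ζ, Kbar (w + T.rangeRestrict ζ) ∂(stepMeasure 𝒞b) := by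
      funext w; exact gaugeLift_integral_comp_add hKloc _ w
    have hDs_a : iteratedFDeriv ℝ s (gaugeLift T (fluct 𝒞a K)) (T.rangeRestrict φ) =
        ∫ ζ, G ζ ∂(stepMeasure 𝒞a) := by
      rw [hlift_a, hDa.iteratedFDeriv_integral_eq s hs]
      refine integral_congr_ae (ae_of_all _ fun ζ => ?_)
      simp only [hG]
      rw [iteratedFDeriv_comp_add_right]
    have hDs_b : iteratedFDeriv ℝ s (gaugeLift T (fluct 𝒞b K)) (T.rangeRestrict φ) =
        ∫ ζ, G ζ ∂(stepMeasure 𝒞b) := by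
      rw [hlift_b, hDb.iteratedFDeriv_integral_eq s hs]
      refine integral_congr_ae (ae_of_all _ fun ζ => ?_)
      simp only [hG]
      rw [iteratedFDeriv_comp_add_right]
    have hca : ContDiff ℝ r₀ (gaugeLift T (fluct 𝒞a K)) :=
      contDiff_gaugeLift T (hSa.contDiff_fluct hD X T hC hKd hKloc hK)
    have hcb : ContDiff ℝ r₀ (gaugeLift T (fluct 𝒞b K)) :=
      contDiff_gaugeLift T (hSb.contDiff_fluct hD X T hC hKd hKloc hK)
    have hsub : gaugeLift T (fluct 𝒞a K - fluct 𝒞b K) =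
        gaugeLift T (fluct 𝒞a K) - gaugeLift T (fluct 𝒞b K) := by
      funext w; rfl
    rw [hsub, iteratedFDeriv_sub_apply ((hca.of_le hs').contDiffAt) ((hcb.of_le hs').contDiffAt),
      hDs_a, hDs_b]
    -- (2) properties of `G`
    have hGcont : Continuous G := by
      show Continuous fun ζ => iteratedFDeriv ℝ s Kbar (T.rangeRestrict φ + gaugeRestrictCLM T ζ)
      exact (hKbar_d.continuous_iteratedFDeriv hs').comp
        (continuous_const.add (gaugeRestrictCLM T).continuous)
    have hGinv : ∀ (ζ : (Fin d → ZMod M) → ℝ) (a : ℝ), G (ζ + fun _ => a) = G ζ := by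
      intro ζ a
      simp only [hG]
      rw [map_add, hTr a, add_zero]
    have hGbound : ∀ ζ, ‖G ζ‖ ≤ (s.factorial : ℝ) * C * W.weight k X (φ + ζ) := by
      intro ζ
      have hcoef := pow_div_factorial_mul_norm_iteratedFDeriv_le_tphiSeminorm r₀ zero_le_one Kbar
        (T.rangeRestrict (φ + ζ)) hs
      rw [one_pow, ← tayNorm_eq_tphiSeminorm] at hcoef
      have hfac : (0 : ℝ) < s.factorial := by positivity
      rw [div_mul_eq_mul_div, one_mul, div_le_iff₀ hfac] at hcoef
      have hpt : T.rangeRestrict φ + T.rangeRestrict ζ = T.rangeRestrict (φ + ζ) := (map_add _ _ _).symm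
      simp only [hG]
      rw [hpt]
      calc ‖iteratedFDeriv ℝ s Kbar (T.rangeRestrict (φ + ζ))‖
          ≤ tayNorm T r₀ K (φ + ζ) * s.factorial := hcoef
        _ ≤ C * W.weight k X (φ + ζ) * s.factorial :=
            mul_le_mul_of_nonneg_right (hK _) (Nat.cast_nonneg _)
        _ = (s.factorial : ℝ) * C * W.weight k X (φ + ζ) := by ring
    have hGm : Continuous fun y : EuclideanSpace ℝ (Fin d → ZMod M) => G (ofLp y) :=
      hGcont.comp (PiLp.continuous_ofLp 2 _)
    -- (3) transfer both expectations to the regularised Gaussians `N(0, mulMat m)`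
    have htra : ∫ ζ, G ζ ∂(stepMeasure 𝒞a) =
        ∫ y, G (ofLp y) ∂(multivariateGaussian (0 : EuclideanSpace ℝ (Fin d → ZMod M)) (mulMat ma)) := by
      rw [← hSa_eq]
      exact integral_stepMeasure_eq_integral_multivariateGaussian_add_constMat hSa.posSemidef zero_le_one
        hGcont.stronglyMeasurable hGinv
    have htrb : ∫ ζ, G ζ ∂(stepMeasure 𝒞b) =
        ∫ y, G (ofLp y) ∂(multivariateGaussian (0 : EuclideanSpace ℝ (Fin d → ZMod M)) (mulMat mb)) := by
      rw [← hSb_eq]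
      exact integral_stepMeasure_eq_integral_multivariateGaussian_add_constMat hSb.posSemidef zero_le_one
        hGcont.stronglyMeasurable hGinv
    rw [htra, htrb]
    -- (4) the `L^p` data along the segment
    have hbound_p : ∀ y : EuclideanSpace ℝ (Fin d → ZMod M),
        ‖G (ofLp y)‖ ^ p ≤ ((s.factorial : ℝ) * C) ^ p * W.weight k X (φ + ofLp y) ^ p := by
      intro y
      rw [← Real.mul_rpow (by positivity) (W.weight_pos k X _).le]
      exact Real.rpow_le_rpow (norm_nonneg _) (hGbound (ofLp y)) hp0.le
    have hseg : ∀ t ∈ Set.Icc (0 : ℝ) 1,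
        MemLp (fun y : EuclideanSpace ℝ (Fin d → ZMod M) => G (ofLp y)) (ENNReal.ofReal p)
            (multivariateGaussian 0 (mulMat (fun κ => mb κ + t * (ma κ - mb κ)))) ∧
          (∫ y, ‖G (ofLp y)‖ ^ p
              ∂(multivariateGaussian 0 (mulMat (fun κ => mb κ + t * (ma κ - mb κ))))) ^ (1 / p) ≤
            (s.factorial : ℝ) * C * (Ap ^ (1 / p) * W.midWeight k X φ) := by
      intro t ht
      rw [hmt_eq t]
      set νt := multivariateGaussian (0 : EuclideanSpace ℝ (Fin d → ZMod M))
        (Matrix.circulant (fun x => 𝒞b x + t * (𝒞a x - 𝒞b x)) + constMat 1) with hνt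
      obtain ⟨hwpt_int, hwpt_le⟩ := integral_weight_rpow_multivariateGaussian_add_constMat_le W hWl hD
        (hpsd_t t ht) zero_le_one hp0 (hSp t ht) hX φ
      have hnormp : Integrable (fun y : EuclideanSpace ℝ (Fin d → ZMod M) => ‖G (ofLp y)‖ ^ p) νt := by
        refine Integrable.mono' (hwpt_int.const_mul (((s.factorial : ℝ) * C) ^ p))
          (hGm.norm.rpow_const fun _ => Or.inr hp0.le).aestronglyMeasurable (ae_of_all _ fun y => ?_)
        rw [Real.norm_of_nonneg (by positivity)]
        exact hbound_p y
      refine ⟨?_, ?_⟩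
      · rw [← integrable_norm_rpow_iff hGm.aestronglyMeasurable hpE ENNReal.ofReal_ne_top,
          ENNReal.toReal_ofReal hp0.le]
        exact hnormp
      · have h1 : ∫ y, ‖G (ofLp y)‖ ^ p ∂νt ≤
            ((s.factorial : ℝ) * C) ^ p * (Ap * W.midWeight k X φ ^ p) := by
          calc ∫ y, ‖G (ofLp y)‖ ^ p ∂νt
              ≤ ∫ y, ((s.factorial : ℝ) * C) ^ p * W.weight k X (φ + ofLp y) ^ p ∂νt :=
                integral_mono_of_nonneg (ae_of_all _ fun y => by positivity)
                  (hwpt_int.const_mul _) (ae_of_all _ fun y => hbound_p y)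
            _ = ((s.factorial : ℝ) * C) ^ p * ∫ y, W.weight k X (φ + ofLp y) ^ p ∂νt :=
                integral_const_mul _ _
            _ ≤ ((s.factorial : ℝ) * C) ^ p * (Ap * W.midWeight k X φ ^ p) :=
                mul_le_mul_of_nonneg_left hwpt_le (by positivity)
        calc (∫ y, ‖G (ofLp y)‖ ^ p ∂νt) ^ (1 / p)
            ≤ (((s.factorial : ℝ) * C) ^ p * (Ap * W.midWeight k X φ ^ p)) ^ (1 / p) :=
              Real.rpow_le_rpow (integral_nonneg fun y => by positivity) h1 (by positivity)
          _ = (s.factorial : ℝ) * C * (Ap ^ (1 / p) * W.midWeight k X φ) := by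
              rw [Real.mul_rpow (by positivity) (mul_nonneg hAp0 (by positivity)),
                Real.mul_rpow hAp0 (by positivity), ← Real.rpow_mul (by positivity),
                ← Real.rpow_mul hwm.le, mul_one_div_cancel hp0.ne', Real.rpow_one, Real.rpow_one]
    -- (5) the dimension-free comparison along the segment
    have hmain := norm_integral_mulMat_sub_le_of_sum_sq_segment (m₀ := mb) (m₁ := ma) (ρ := ρ)
      hmb_pos hma_pos hmb_ev hma_ev hρb hρa hhS hsum hpq
      (H := fun y : EuclideanSpace ℝ (Fin d → ZMod M) => G (ofLp y))
      (fun t ht => (hseg t ht).1) (fun t ht => (hseg t ht).2)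
    refine hmain.trans (le_of_eq ?_)
    ring
  -- (6) sum over the Taylor orders
  show tayNorm T r₀ (fluct 𝒞a K - fluct 𝒞b K) φ ≤ _
  unfold tayNorm
  calc ∑ s ∈ Finset.range (r₀ + 1), ((s.factorial : ℝ)⁻¹) *
        ‖iteratedFDeriv ℝ s (gaugeLift T (fluct 𝒞a K - fluct 𝒞b K)) (T.rangeRestrict φ)‖
      ≤ ∑ _s ∈ Finset.range (r₀ + 1), C * (8 * q * hS * Ap ^ (1 / p)) * W.midWeight k X φ := by
        refine sum_le_sum fun s hs => ?_
        have hs' : s ≤ r₀ := Nat.lt_succ_iff.1 (mem_range.1 hs)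
        have hfac : (0 : ℝ) < s.factorial := by positivity
        calc ((s.factorial : ℝ)⁻¹) *
              ‖iteratedFDeriv ℝ s (gaugeLift T (fluct 𝒞a K - fluct 𝒞b K)) (T.rangeRestrict φ)‖
            ≤ ((s.factorial : ℝ)⁻¹) *
                ((s.factorial : ℝ) * C * (8 * q * hS * Ap ^ (1 / p)) * W.midWeight k X φ) :=
              mul_le_mul_of_nonneg_left (hterm s hs') (by positivity)
          _ = C * (8 * q * hS * Ap ^ (1 / p)) * W.midWeight k X φ := by
              field_simp
    _ = C * ((r₀ + 1) * (8 * q * hS) * Ap ^ (1 / p)) * W.midWeight k X φ := by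
        rw [sum_const, card_range, nsmul_eq_mul]
        push_cast
        ring

/-! ## The estimate for the concrete norm parameters -/

/-- **[ABKM19] Lemma 8.4 (`ℓ = 1`, dimension-free form) for the torus norm parameters**: for the weight
tower of Theorem 7.1 (`AbkmWeightBounds`), two even zero-sum step kernels `𝒞a, 𝒞b` with
`StepKernelBounds` at scale `k` and positive multipliers off the zero mode, a mode-wise two-sided
relative bound `ρ ≥ 0` with `Σ_κ ρ(κ)² ≤ h_T²`, Hölder conjugates `p, q` and `StepKernelBounds` for the
dilated segment kernels `p·𝒞_t` (constant `A𝒫p`), a `k`-polymer `X` and a `T_k^{X*}`-local `C^{r₀}`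
functional `K` with `‖K‖_{k,X} ≤ C`:
`‖fluct 𝒞a K − fluct 𝒞b K‖_{k:k+1,X} ≤ C · ((r₀+1) · (8 q h_T) · (A𝒫p^{|X|_k})^{1/p})`.
[cite: AdamsBuchholzKoteckyMuller2019, Lemma 8.4] -/
theorem tayNormLE_fluct_sub_fluct_of_sum_sq_abkm {L N Mord R n pT r₀ : ℕ}
    {θbar lam μ δ₁ δ₀ A𝒫 A𝒫a A𝒫b A𝒫p C₂a C₂b C₂p h A : ℝ} {𝒞 : ℕ → (Fin d → ZMod M) → ℝ}
    {𝒞a 𝒞b : (Fin d → ZMod M) → ℝ}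
    (hB : AbkmWeightBounds L N Mord R n θbar lam μ δ₁ δ₀ A𝒫 𝒞
      (abkmWeightData L N Mord R θbar (schedDelta δ₀ δ₁ N) 𝒞))
    {k : ℕ}
    (hSa : StepKernelBounds (abkmWeightData L N Mord R θbar (schedDelta δ₀ δ₁ N) 𝒞) L k A𝒫a C₂a 𝒞a)
    (hSb : StepKernelBounds (abkmWeightData L N Mord R θbar (schedDelta δ₀ δ₁ N) 𝒞) L k A𝒫b C₂b 𝒞b)
    {p q : ℝ} (hpq : p.HolderConjugate q)
    (hSp : ∀ t ∈ Set.Icc (0 : ℝ) 1,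
      StepKernelBounds (abkmWeightData L N Mord R θbar (schedDelta δ₀ δ₁ N) 𝒞) L k A𝒫p C₂p
        (fun x => p * (𝒞b x + t * (𝒞a x - 𝒞b x))))
    (hea : ∀ x, 𝒞a (-x) = 𝒞a x) (heb : ∀ x, 𝒞b (-x) = 𝒞b x)
    (h0a : ∑ x, 𝒞a x = 0) (h0b : ∑ x, 𝒞b x = 0)
    (hposa : ∀ κ, κ ≠ 0 → 0 < (fourierCoeff 𝒞a κ).re)
    (hposb : ∀ κ, κ ≠ 0 → 0 < (fourierCoeff 𝒞b κ).re)
    {ρ : (Fin d → ZMod M) → ℝ} (hρ : ∀ κ, 0 ≤ ρ κ)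
    (hcmpa : ∀ κ, |(fourierCoeff 𝒞a κ).re - (fourierCoeff 𝒞b κ).re| ≤ ρ κ * (fourierCoeff 𝒞a κ).re)
    (hcmpb : ∀ κ, |(fourierCoeff 𝒞a κ).re - (fourierCoeff 𝒞b κ).re| ≤ ρ κ * (fourierCoeff 𝒞b κ).re)
    {hS : ℝ} (hhS : 0 ≤ hS) (hsum : ∑ κ, ρ κ ^ 2 ≤ hS ^ 2)
    {X : Finset (Fin d → ZMod M)} (hX : IsPolymer (L ^ k) X)
    {K : ((Fin d → ZMod M) → ℝ) → ℂ} {C : ℝ} (hC : 0 ≤ C) (hKd : ContDiff ℝ r₀ K)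
    (hKloc : IsGaugeLocal ((abkmNormParams L N Mord R pT r₀ h θbar A (schedDelta δ₀ δ₁ N) 𝒞).gauge k X) K)
    (hK : TayNormLE ((abkmNormParams L N Mord R pT r₀ h θbar A (schedDelta δ₀ δ₁ N) 𝒞).gauge k X) r₀
      ((abkmWeightData L N Mord R θbar (schedDelta δ₀ δ₁ N) 𝒞).weight k X) K C) :
    TayNormLE ((abkmNormParams L N Mord R pT r₀ h θbar A (schedDelta δ₀ δ₁ N) 𝒞).gauge k X) r₀
      ((abkmWeightData L N Mord R θbar (schedDelta δ₀ δ₁ N) 𝒞).midWeight k X) (fluct 𝒞a K - fluct 𝒞b K)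
      (C * ((r₀ + 1) * (8 * q * hS) * (A𝒫p ^ numBlocks (L ^ k) X) ^ (1 / p))) :=
  tayNormLE_fluct_sub_fluct_of_sum_sq _ hB.isLocal hB.dominated hSa hSb hpq hSp hea heb h0a h0b hposa hposb
    hρ hcmpa hcmpb hhS hsum hX _ (gauge_const _ k X) hC hKd hKloc hK

/-- **The same with the constant in product form** `b · ℓ · κ^{|X|_k}`, `ℓ = (r₀+1)·8q·h_T`,
`κ = A𝒫p^{1/p}` (`A𝒫p ≥ 0`). [cite: AdamsBuchholzKoteckyMuller2019, Lemma 8.4] -/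
theorem tayNormLE_fluct_sub_fluct_of_sum_sq_pow_abkm {L N Mord R n pT r₀ : ℕ}
    {θbar lam μ δ₁ δ₀ A𝒫 A𝒫a A𝒫b A𝒫p C₂a C₂b C₂p h A : ℝ} {𝒞 : ℕ → (Fin d → ZMod M) → ℝ}
    {𝒞a 𝒞b : (Fin d → ZMod M) → ℝ}
    (hB : AbkmWeightBounds L N Mord R n θbar lam μ δ₁ δ₀ A𝒫 𝒞
      (abkmWeightData L N Mord R θbar (schedDelta δ₀ δ₁ N) 𝒞))
    {k : ℕ}
    (hSa : StepKernelBounds (abkmWeightData L N Mord R θbar (schedDelta δ₀ δ₁ N) 𝒞) L k A𝒫a C₂a 𝒞a)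
    (hSb : StepKernelBounds (abkmWeightData L N Mord R θbar (schedDelta δ₀ δ₁ N) 𝒞) L k A𝒫b C₂b 𝒞b)
    {p q : ℝ} (hpq : p.HolderConjugate q)
    (hSp : ∀ t ∈ Set.Icc (0 : ℝ) 1,
      StepKernelBounds (abkmWeightData L N Mord R θbar (schedDelta δ₀ δ₁ N) 𝒞) L k A𝒫p C₂p
        (fun x => p * (𝒞b x + t * (𝒞a x - 𝒞b x))))
    (hA𝒫p : 0 ≤ A𝒫p)
    (hea : ∀ x, 𝒞a (-x) = 𝒞a x) (heb : ∀ x, 𝒞b (-x) = 𝒞b x)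
    (h0a : ∑ x, 𝒞a x = 0) (h0b : ∑ x, 𝒞b x = 0)
    (hposa : ∀ κ, κ ≠ 0 → 0 < (fourierCoeff 𝒞a κ).re)
    (hposb : ∀ κ, κ ≠ 0 → 0 < (fourierCoeff 𝒞b κ).re)
    {ρ : (Fin d → ZMod M) → ℝ} (hρ : ∀ κ, 0 ≤ ρ κ)
    (hcmpa : ∀ κ, |(fourierCoeff 𝒞a κ).re - (fourierCoeff 𝒞b κ).re| ≤ ρ κ * (fourierCoeff 𝒞a κ).re)
    (hcmpb : ∀ κ, |(fourierCoeff 𝒞a κ).re - (fourierCoeff 𝒞b κ).re| ≤ ρ κ * (fourierCoeff 𝒞b κ).re)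
    {hS : ℝ} (hhS : 0 ≤ hS) (hsum : ∑ κ, ρ κ ^ 2 ≤ hS ^ 2)
    {X : Finset (Fin d → ZMod M)} (hX : IsPolymer (L ^ k) X)
    {F : ((Fin d → ZMod M) → ℝ) → ℂ} {b : ℝ} (hb : 0 ≤ b) (hFd : ContDiff ℝ r₀ F)
    (hFloc : IsGaugeLocal ((abkmNormParams L N Mord R pT r₀ h θbar A (schedDelta δ₀ δ₁ N) 𝒞).gauge k X) F)
    (hF : TayNormLE ((abkmNormParams L N Mord R pT r₀ h θbar A (schedDelta δ₀ δ₁ N) 𝒞).gauge k X) r₀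
      ((abkmWeightData L N Mord R θbar (schedDelta δ₀ δ₁ N) 𝒞).weight k X) F b) :
    TayNormLE ((abkmNormParams L N Mord R pT r₀ h θbar A (schedDelta δ₀ δ₁ N) 𝒞).gauge k X) r₀
      ((abkmWeightData L N Mord R θbar (schedDelta δ₀ δ₁ N) 𝒞).midWeight k X) (fluct 𝒞a F - fluct 𝒞b F)
      (b * ((r₀ + 1) * (8 * q * hS)) * (A𝒫p ^ (1 / p)) ^ numBlocks (L ^ k) X) := by
  have h := tayNormLE_fluct_sub_fluct_of_sum_sq_abkm hB hSa hSb hpq hSp hea heb h0a h0b hposa hposb hρ hcmpa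
    hcmpb hhS hsum hX hb hFd hFloc hF (pT := pT) (h := h) (A := A)
  rw [pow_rpow_inv_eq_rpow_inv_pow hA𝒫p] at h
  convert h using 1
  ring

end Literature.MathematicalPhysics.StatisticalMechanics.GradientRG

end
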